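import Summits.ValiantsHypothesis.ValiantsHypothesis.Theorems.LacunarySymmetroidMatrixDescartesWLawTwoSixTools

/-!
# `MatrixDescartes` census — the WEIGHTED FOUR-NOMIAL LEMMA (unequal gaps):
# `A − B X^{g₁} + C X^{q} − D X^{q+g₃}` has at most one positive root as soon as `B^{g₃} C^{g₁} ≤ A^{g₃} D^{g₁}`

HONEST FRAMING.  Object-search cell `pub-symmetroid`, seat `val-sym-mdr-p1` (generation 6); helper file landed `--supports`
the crux item stmt-ValiantsHypothesis-18050 (`Theses.LacunarySymmetroid.MatrixDescartes`, OPEN, on HOLD) with NO closure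
claim.  A scalar fewnomial tool for the `(2, K)` pivot rows (the chamber programme behind «`PivotRootLawAt 2 4 q 8`»,
entry point `…CensusPivotTwoElimination.lean`): the tree's FOUR-NOMIAL LEMMA
(`WLawTwoSix.fourNomial_countP_posRoots_le_one`, seat g5: equal outer gaps `g`, hypothesis `BC ≤ AD`) is generalised to
UNEQUAL outer gaps `g₁`, `g₃` under the weighted hypothesis `B^{g₃}·C^{g₁} ≤ A^{g₃}·D^{g₁}` (for `g₁ = g₃` this is
`(BC)^{g} ≤ (AD)^{g}`, i.e. the old hypothesis).  PROOF (same mechanism): with the threshold `x₀ = (C/D)^{1/g₃}`, below `x₀`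
one has `D x^{g₃} < C` and `(B x^{g₁})^{g₃} = B^{g₃}(x^{g₃})^{g₁} ≤ B^{g₃}(C/D)^{g₁} ≤ A^{g₃}`, so `B x^{g₁} ≤ A` and the
fewnomial is positive; from `x₀` on, Euler's operator gives `x·φ′ = −g₁Bx^{g₁} + qCx^{q} − (q+g₃)Dx^{q+g₃} < 0`, so `φ` is
strictly decreasing; hence at most one positive root, multiplicity included (`fourNomial_countP_posRoots_le_one_weighted`);
the distinct-root form is `fourNomial_card_posRoots_le_one_weighted`; for `g₁ = g₃` the hypothesis is
`(BC)^g ≤ (AD)^g`, so the tree's equal-gap lemma is the special case (not restated).  In the seat's located census of the `(2,4)` row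
(82 `V = 10` order types) the two-twist certificates are tested with exactly this weighted condition; the equal-gap lever
blocks cover 8 types with a uniform multiplier margin, the weighted form is what the remaining types are probed with.
Nothing here bears on `Theses.LacunarySymmetroid.MatrixDescartes` in its window, on `KPlusLogSqLaw`, on `DoorA26` /
`DoorA34`, on the cell's registers or credences, or on `VP ≠ VNP`.

[folklore] Elementary calculus (a Descartes-type count with one magnitude condition); tree lemmas
`WLawTwoSix.countP_posRoots_le_one_of_pos_of_deriv_neg`, `WLawTwoSix.eval_X_mul_derivative_fourNomial`,
`Census.countP_posRoots_X_pow_mul`, `Literature.Algebra.Polynomial.Descartes.signVariations_eq_zero_of_coeff_nonneg`.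
No definitions, no named facts.
-/

-- `Summit.ValiantsHypothesis.ValiantsHypothesis.…` repeats a component by the D-0017 layout
-- (single-conjunct summit), which the `dupNamespace` linter flags; the name is mandated.
set_option linter.dupNamespace false

namespace Summit.ValiantsHypothesis.ValiantsHypothesis.Theorems.LacunarySymmetroidMatrixDescartes.WLawTwoSix

open Polynomial Finset
open scoped BigOperators Polynomial

/-- **Weighted four-nomial lemma** (positive roots WITH multiplicity).  For `A, B, C, D ≥ 0`, gaps `g₁, g₃ ≥ 1`, any `p, q`,
and the weighted lever condition `B^{g₃} · C^{g₁} ≤ A^{g₃} · D^{g₁}`, the fewnomial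
`A X^p − B X^{p+g₁} + C X^{p+q} − D X^{p+q+g₃}` has at most one positive root counted with multiplicity. [folklore] -/
theorem fourNomial_countP_posRoots_le_one_weighted (A B Cc D : ℝ) (hA : 0 ≤ A) (hB : 0 ≤ B) (hC : 0 ≤ Cc)
    (hD : 0 ≤ D) (p g₁ q g₃ : ℕ) (hg₁ : 0 < g₁) (hg₃ : 0 < g₃)
    (hlev : B ^ g₃ * Cc ^ g₁ ≤ A ^ g₃ * D ^ g₁) :
    (C A * X ^ p - C B * X ^ (p + g₁) + C Cc * X ^ (p + q) - C D * X ^ (p + q + g₃)).roots.countP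
      (fun x => 0 < x) ≤ 1 := by
  -- pull out `X^p`
  have hfac : C A * X ^ p - C B * X ^ (p + g₁) + C Cc * X ^ (p + q) - C D * X ^ (p + q + g₃)
      = X ^ p * (C A * X ^ 0 + C (-B) * X ^ g₁ + C Cc * X ^ q + C (-D) * X ^ (q + g₃)) := by
    simp only [map_neg, pow_add, pow_zero]
    ring
  rw [hfac, Census.countP_posRoots_X_pow_mul]
  set φ : ℝ[X] := C A * X ^ 0 + C (-B) * X ^ g₁ + C Cc * X ^ q + C (-D) * X ^ (q + g₃) with hφ
  have heval : ∀ x : ℝ, φ.eval x = A - B * x ^ g₁ + x ^ q * (Cc - D * x ^ g₃) := by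
    intro x
    simp only [hφ, eval_add, eval_mul, eval_C, eval_pow, eval_X, pow_add]
    ring
  -- Euler's operator beyond a point where `D x^{g₃} ≥ C` (and `D > 0`): `x φ' < 0`
  have hEuler : ∀ x : ℝ, 0 < x → 0 < D → Cc ≤ D * x ^ g₃ → φ.derivative.eval x < 0 := by
    intro x hx hDpos h1
    have hE : (X * derivative φ).eval x < 0 := by
      rw [hφ, eval_X_mul_derivative_fourNomial]
      simp only [Nat.cast_zero, zero_mul, Nat.cast_add]
      have hxq : 0 < x ^ q := pow_pos hx q
      have hxg₁ : 0 < x ^ g₁ := pow_pos hx g₁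
      have hxg₃ : 0 < x ^ g₃ := pow_pos hx g₃
      have key : (q : ℝ) * Cc * x ^ q - ((q : ℝ) + g₃) * D * x ^ (q + g₃) < 0 := by
        rw [pow_add]
        have hq0 : (0 : ℝ) ≤ q := Nat.cast_nonneg q
        have hg0 : (0 : ℝ) < g₃ := by exact_mod_cast hg₃
        nlinarith [mul_nonneg hq0 (mul_nonneg hxq.le (sub_nonneg.mpr h1)),
          mul_pos (mul_pos hg0 hDpos) (mul_pos hxq hxg₃)]
      nlinarith [mul_nonneg (mul_nonneg (Nat.cast_nonneg g₁) hB) hxg₁.le]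
    have h2 : (X * derivative φ).eval x = x * φ.derivative.eval x := by rw [eval_mul, eval_X]
    rw [h2] at hE
    rcases lt_or_ge (φ.derivative.eval x) 0 with h' | h'
    · exact h'
    · exact absurd hE (not_lt.mpr (mul_nonneg hx.le h'))
  rcases hD.eq_or_lt with hD0 | hDpos
  · -- `D = 0`: then `B = 0` or `C = 0`
    have hBC : B ^ g₃ * Cc ^ g₁ = 0 :=
      le_antisymm (by rw [← hD0, zero_pow hg₁.ne', mul_zero] at hlev; exact hlev) (by positivity)
    rcases mul_eq_zero.mp hBC with hB0 | hC0
    · -- all coefficients `≥ 0`: no positive root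
      have hB0' : B = 0 := pow_eq_zero_iff hg₃.ne' |>.mp hB0
      have hnn : ∀ n, 0 ≤ φ.coeff n := by
        intro n
        simp only [hφ, ← hD0, hB0', neg_zero, map_zero, zero_mul, add_zero, coeff_add, coeff_C_mul,
          coeff_X_pow]
        split_ifs <;> nlinarith
      have hV := Literature.Algebra.Polynomial.Descartes.signVariations_eq_zero_of_coeff_nonneg hnn
      have := φ.roots_countP_pos_le_signVariations
      omega
    · -- `φ = A − B X^{g₁}`
      have hC0' : Cc = 0 := pow_eq_zero_iff hg₁.ne' |>.mp hC0
      rcases hB.eq_or_lt with hB0 | hBpos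
      · have hnn : ∀ n, 0 ≤ φ.coeff n := by
          intro n
          simp only [hφ, ← hD0, ← hB0, hC0', neg_zero, map_zero, zero_mul, add_zero, coeff_C_mul,
            coeff_X_pow]
          split_ifs <;> nlinarith
        have hV := Literature.Algebra.Polynomial.Descartes.signVariations_eq_zero_of_coeff_nonneg hnn
        have := φ.roots_countP_pos_le_signVariations
        omega
      · refine countP_posRoots_le_one_of_pos_of_deriv_neg φ 0 (fun x hx hx0 => absurd hx0 (not_lt.mpr hx.le))
          fun x _ hx => ?_
        have h1 : (X * derivative φ).eval x < 0 := by
          rw [hφ, eval_X_mul_derivative_fourNomial, ← hD0, hC0']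
          simp only [Nat.cast_zero, zero_mul, neg_zero, mul_zero, add_zero, zero_add]
          have : 0 < (g₁ : ℝ) * B * x ^ g₁ := by positivity
          linarith
        have h2 : (X * derivative φ).eval x = x * φ.derivative.eval x := by rw [eval_mul, eval_X]
        rw [h2] at h1
        rcases lt_or_ge (φ.derivative.eval x) 0 with h' | h'
        · exact h'
        · exact absurd h1 (not_lt.mpr (mul_nonneg hx.le h'))
  · -- `D > 0`: threshold `x₀` with `x₀ ^ g₃ = C / D`
    set x₀ : ℝ := (Cc / D) ^ ((g₃ : ℝ)⁻¹) with hx₀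
    have hx₀nn : 0 ≤ x₀ := Real.rpow_nonneg (div_nonneg hC hDpos.le) _
    have hx₀g : x₀ ^ g₃ = Cc / D := Real.rpow_inv_natCast_pow (div_nonneg hC hDpos.le) hg₃.ne'
    refine countP_posRoots_le_one_of_pos_of_deriv_neg φ x₀ (fun x hx hxx₀ => ?_) (fun x hx₀x hx => ?_)
    · -- positivity below the threshold
      have hxg : x ^ g₃ < Cc / D := by
        rw [← hx₀g]; exact pow_lt_pow_left₀ hxx₀ hx.le hg₃.ne'
      have h1 : D * x ^ g₃ < Cc := by rwa [lt_div_iff₀ hDpos, mul_comm] at hxg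
      -- `(B x^{g₁})^{g₃} ≤ A^{g₃}` from the weighted lever condition
      have h2 : B * x ^ g₁ ≤ A := by
        have hDg : 0 < D ^ g₁ := pow_pos hDpos g₁
        have hx3 : (x ^ g₃) ^ g₁ ≤ (Cc / D) ^ g₁ := pow_le_pow_left₀ (pow_nonneg hx.le _) hxg.le g₁
        have hpow : (B * x ^ g₁) ^ g₃ ≤ A ^ g₃ := by
          have e1 : (B * x ^ g₁) ^ g₃ = B ^ g₃ * (x ^ g₃) ^ g₁ := by rw [mul_pow, ← pow_mul, ← pow_mul, mul_comm g₁]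
          rw [e1]
          have e2 : (Cc / D) ^ g₁ = Cc ^ g₁ / D ^ g₁ := div_pow Cc D g₁
          have h3 : B ^ g₃ * (x ^ g₃) ^ g₁ ≤ B ^ g₃ * (Cc ^ g₁ / D ^ g₁) := by
            rw [← e2]; exact mul_le_mul_of_nonneg_left hx3 (pow_nonneg hB _)
          have h4 : B ^ g₃ * (Cc ^ g₁ / D ^ g₁) ≤ A ^ g₃ := by
            rw [mul_div_assoc', div_le_iff₀ hDg]
            exact hlev
          exact h3.trans h4
        exact (pow_le_pow_iff_left₀ (mul_nonneg hB (pow_nonneg hx.le _)) hA hg₃.ne').mp hpow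
      rw [heval]
      have : 0 < x ^ q * (Cc - D * x ^ g₃) := mul_pos (pow_pos hx q) (by linarith)
      linarith
    · -- strict decrease beyond the threshold
      have hxg : Cc / D ≤ x ^ g₃ := by
        rw [← hx₀g]; exact pow_le_pow_left₀ hx₀nn hx₀x g₃
      have h1 : Cc ≤ D * x ^ g₃ := by rwa [div_le_iff₀ hDpos, mul_comm] at hxg
      exact hEuler x hx hDpos h1

/-- **Weighted four-nomial lemma, distinct-root form**: under the hypotheses of
`fourNomial_countP_posRoots_le_one_weighted`, `A X^p − B X^{p+g₁} + C X^{p+q} − D X^{p+q+g₃}` has at most one distinct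
positive root. [folklore] -/
theorem fourNomial_card_posRoots_le_one_weighted (A B Cc D : ℝ) (hA : 0 ≤ A) (hB : 0 ≤ B) (hC : 0 ≤ Cc)
    (hD : 0 ≤ D) (p g₁ q g₃ : ℕ) (hg₁ : 0 < g₁) (hg₃ : 0 < g₃)
    (hlev : B ^ g₃ * Cc ^ g₁ ≤ A ^ g₃ * D ^ g₁) :
    ((C A * X ^ p - C B * X ^ (p + g₁) + C Cc * X ^ (p + q) - C D * X ^ (p + q + g₃)).roots.toFinset.filter
      (fun x => 0 < x)).card ≤ 1 :=
  (Census.card_posRoots_le_countP_posRoots _).trans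
    (fourNomial_countP_posRoots_le_one_weighted A B Cc D hA hB hC hD p g₁ q g₃ hg₁ hg₃ hlev)

end Summit.ValiantsHypothesis.ValiantsHypothesis.Theorems.LacunarySymmetroidMatrixDescartes.WLawTwoSix
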